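import Mathlib
import Summits.Ventures.PercRepro2.Tail2DBlockCalc
import Summits.Ventures.PercRepro2.Tail2DHarrisSP
import Summits.Ventures.PercRepro2.Tail2DFlowOneBlocks
import Summits.Ventures.PercRepro2.Tail2DFlowOneStep01
import Summits.Ventures.PercRepro2.Tail2DParFin
import Summits.Ventures.PercRepro2.Tail2DParFinFlip
import Summits.Ventures.PercRepro2.Tail2DParFinTop
import Summits.Ventures.PercRepro2.Tail2DParFinDiag
import Summits.Ventures.PercRepro2.Tail2DParFinCount
import Summits.Ventures.PercRepro2.Tail2DParFinRelax
import Summits.Ventures.PercRepro2.Tail2DParFinSubTop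
import Summits.Ventures.PercRepro2.Tail2DParFinSubTopB
import Summits.Ventures.PercRepro2.Tail2DOneChange

/-!
# The one-change certificate with arbitrary rate tables, part II: the target side and the theorem
(seat mine-b, cell pub-perc-repro2; conjectures/MINE-B.md §44)

`sdomZ_of_oneChange`: a one-change rate table whose rates are non-negative and satisfy the source identity
(`OCRates.SrcOK`) and the target identity (`OCRates.TgtOK`: every word of the target tail receives
`λ = |E(u,v)|/|E(u−1,v+1)|` — its identity, the flips and relax-B outcomes of its unflips at its blue positions and
the relax-C outcomes of its updates by `R` at its `C` positions) proves (SD) at `(u, v)` on `X₀ ∥ … ∥ X_{k−1}`.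
-/

namespace Summit.Ventures.PercRepro2.Tail2D

open V2Closure Finset

section OCTarget

variable (k : ℕ) (X : Fin k → V2Closure.SP) (u v : ℕ)

/-- the target term of an index at a configuration, for a rate table -/
noncomputable def ocTerm (R : OCRates k) (w : Fin k → Ltr) (i : Fin k) (m : Fin 3) (z : (parFin k X).Conf) : ℚ :=
  if ocId k u v w i m ∧ wordOf k X z = w then R.ι w / k / tailCount (parFin k X) u v
  else if ocFl k u v w i m ∧ wordOf k X z = flipSet k w {i} then R.f w i / tailCount (parFin k X) u v
  else if ocRx k u v w i m ∧ (wordOf k X z = Function.update w i Ltr.B ∨ wordOf k X z = Function.update w i Ltr.C)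
    then R.x w i / tailCount (parFin k X) u v
  else 0

variable {k X u v}

/-- the target term of an index at a configuration -/
theorem oc_tgt_term (hX : ∀ i, FlowOne (X i)) (R : OCRates k) (w : Fin k → Ltr) (i : Fin k) (m : Fin 3)
    (z : (parFin k X).Conf) :
    ocW k X u v R w i m * unifDens (parFin k X) (ocQ k X u v w i m) z = ocTerm k X u v R w i m z := by
  unfold ocW ocQ ocTerm
  by_cases h1 : ocId k u v w i m
  · have nf := ocId_not_fl w i m h1
    have nr := ocId_not_rx w i m h1
    rw [if_pos h1, if_pos h1, unifDens_blockOf k X hX,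
      if_neg (show ¬ (ocRx k u v w i m ∧ (wordOf k X z = Function.update w i Ltr.B ∨
        wordOf k X z = Function.update w i Ltr.C)) from fun h => nr h.1),
      if_neg (show ¬ (ocFl k u v w i m ∧ wordOf k X z = flipSet k w {i}) from fun h => nf h.1)]
    by_cases hz : wordOf k X z = w
    · rw [if_pos hz, if_pos (show ocId k u v w i m ∧ wordOf k X z = w from ⟨h1, hz⟩)]
      have hpos : (0 : ℚ) < (blockOf k X w).card := by
        rw [← hz]; exact_mod_cast card_blockOf_wordOf_pos k X hX z
      field_simp
    · rw [if_neg hz, if_neg (show ¬ (ocId k u v w i m ∧ wordOf k X z = w) from fun h => hz h.2), mul_zero]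
  · rw [if_neg h1, if_neg h1, if_neg (show ¬ (ocId k u v w i m ∧ wordOf k X z = w) from fun h => h1 h.1)]
    by_cases h2 : ocFl k u v w i m
    · have nr := ocFl_not_rx w i m h2
      rw [if_pos h2, if_pos h2, unifDens_blockOf k X hX,
        if_neg (show ¬ (ocRx k u v w i m ∧ (wordOf k X z = Function.update w i Ltr.B ∨
          wordOf k X z = Function.update w i Ltr.C)) from fun h => nr h.1)]
      have hJ : ({i} : Finset (Fin k)) ⊆ redSet k w := by
        intro j hj; rw [Finset.mem_singleton] at hj; subst hj; simp [redSet, h2.2.2]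
      by_cases hz : wordOf k X z = flipSet k w {i}
      · rw [if_pos hz, if_pos (show ocFl k u v w i m ∧ wordOf k X z = flipSet k w {i} from ⟨h2, hz⟩),
          card_blockOf_flipSet k X w {i} hJ]
        have hpos : (0 : ℚ) < (blockOf k X w).card := by
          rw [← card_blockOf_flipSet k X w {i} hJ, ← hz]; exact_mod_cast card_blockOf_wordOf_pos k X hX z
        field_simp
      · rw [if_neg hz, if_neg (show ¬ (ocFl k u v w i m ∧ wordOf k X z = flipSet k w {i}) from fun h => hz h.2),
          mul_zero]
    · rw [if_neg h2, if_neg h2, if_neg (show ¬ (ocFl k u v w i m ∧ wordOf k X z = flipSet k w {i}) from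
        fun h => h2 h.1)]
      by_cases h3 : ocRx k u v w i m
      · rw [if_pos h3, if_pos h3, unifDens_blockCol k X hX]
        by_cases hz : wordOf k X z = Function.update w i Ltr.B ∨ wordOf k X z = Function.update w i Ltr.C
        · rw [if_pos hz, if_pos (show ocRx k u v w i m ∧ (wordOf k X z = Function.update w i Ltr.B ∨
            wordOf k X z = Function.update w i Ltr.C) from ⟨h3, hz⟩)]
          have hpos : (0 : ℚ) < (blockCol k X w i).card := by
            exact_mod_cast Finset.card_pos.2 ⟨z, (mem_blockCol_iff k X hX w i z).2 hz⟩
          field_simp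
        · rw [if_neg hz, if_neg (show ¬ (ocRx k u v w i m ∧ (wordOf k X z = Function.update w i Ltr.B ∨
            wordOf k X z = Function.update w i Ltr.C)) from fun h => hz h.2), mul_zero]
      · rw [if_neg h3, if_neg h3, if_neg (show ¬ (ocRx k u v w i m ∧ (wordOf k X z = Function.update w i Ltr.B ∨
            wordOf k X z = Function.update w i Ltr.C)) from fun h => h3 h.1), zero_mul]

/-- `m = 0`: only the word itself contributes -/
theorem sum_ocTerm_zero (R : OCRates k) (i : Fin k) (z : (parFin k X).Conf) :
    ∑ w, ocTerm k X u v R w i 0 z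
      = if ocCom k u v (wordOf k X z) then R.ι (wordOf k X z) / k / tailCount (parFin k X) u v else 0 := by
  have h1 : ¬ ((0 : Fin 3) = 1) := by decide
  have h2 : ¬ ((0 : Fin 3) = 2) := by decide
  set w0 := wordOf k X z with hw0
  have hoff : ∀ w : Fin k → Ltr, ocTerm k X u v R w i 0 z
      = if ocCom k u v w ∧ w0 = w then R.ι w / k / tailCount (parFin k X) u v else 0 := by
    intro w
    unfold ocTerm
    rw [if_neg (show ¬ (ocFl k u v w i 0 ∧ w0 = flipSet k w {i}) from fun h => h1 h.1.1),
      if_neg (show ¬ (ocRx k u v w i 0 ∧ (w0 = Function.update w i Ltr.B ∨ w0 = Function.update w i Ltr.C)) from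
        fun h => h2 h.1.1)]
    by_cases hc : ocCom k u v w ∧ w0 = w
    · rw [if_pos (show ocId k u v w i 0 ∧ w0 = w from ⟨⟨rfl, hc.1⟩, hc.2⟩), if_pos hc]
    · rw [if_neg (show ¬ (ocId k u v w i 0 ∧ w0 = w) from fun h => hc ⟨h.1.2, h.2⟩), if_neg hc]
  simp only [hoff]
  rw [Finset.sum_eq_single w0]
  · by_cases hc : ocCom k u v w0
    · rw [if_pos ⟨hc, rfl⟩, if_pos hc]
    · rw [if_neg (fun h => hc h.1), if_neg hc]
  · intro w _ hw
    rw [if_neg (fun h => hw h.2.symm)]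
  · intro h; exact absurd (Finset.mem_univ _) h

/-- `m = 1`: only the unflip of the word at a blue position contributes -/
theorem sum_ocTerm_one (R : OCRates k) (i : Fin k) (z : (parFin k X).Conf) :
    ∑ w, ocTerm k X u v R w i 1 z
      = if wordOf k X z i = Ltr.B ∧ ocSrc k u v (Function.update (wordOf k X z) i Ltr.R)
        then R.f (Function.update (wordOf k X z) i Ltr.R) i / tailCount (parFin k X) u v else 0 := by
  have h0 : ¬ ((1 : Fin 3) = 0) := by decide
  have h2 : ¬ ((1 : Fin 3) = 2) := by decide
  set w0 := wordOf k X z with hw0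
  have hoff : ∀ w : Fin k → Ltr, ocTerm k X u v R w i 1 z
      = if ocSrc k u v w ∧ w i = Ltr.R ∧ w0 = Function.update w i Ltr.B
        then R.f w i / tailCount (parFin k X) u v else 0 := by
    intro w
    unfold ocTerm
    rw [if_neg (show ¬ (ocId k u v w i 1 ∧ w0 = w) from fun h => h0 h.1.1),
      if_neg (show ¬ (ocRx k u v w i 1 ∧ (w0 = Function.update w i Ltr.B ∨ w0 = Function.update w i Ltr.C)) from
        fun h => h2 h.1.1), flipSet_singleton]
    by_cases hc : ocSrc k u v w ∧ w i = Ltr.R ∧ w0 = Function.update w i Ltr.B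
    · rw [if_pos (show ocFl k u v w i 1 ∧ w0 = Function.update w i Ltr.B from ⟨⟨rfl, hc.1, hc.2.1⟩, hc.2.2⟩),
        if_pos hc]
    · rw [if_neg (show ¬ (ocFl k u v w i 1 ∧ w0 = Function.update w i Ltr.B) from
        fun h => hc ⟨h.1.2.1, h.1.2.2, h.2⟩), if_neg hc]
  simp only [hoff]
  rw [Finset.sum_eq_single (Function.update w0 i Ltr.R)]
  · by_cases hc : w0 i = Ltr.B ∧ ocSrc k u v (Function.update w0 i Ltr.R)
    · rw [if_pos hc, if_pos (show ocSrc k u v (Function.update w0 i Ltr.R) ∧ Function.update w0 i Ltr.R i = Ltr.R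
        ∧ w0 = Function.update (Function.update w0 i Ltr.R) i Ltr.B from
        ⟨hc.2, by simp, by rw [Function.update_idem, ← hc.1, Function.update_eq_self]⟩)]
    · rw [if_neg hc, if_neg]
      rintro ⟨hs, -, hz⟩
      apply hc
      refine ⟨?_, hs⟩
      have := congrFun hz i
      simpa using this
  · intro w _ hw
    rw [if_neg]
    rintro ⟨-, hi, hz⟩
    apply hw
    rw [hz, Function.update_idem, ← hi, Function.update_eq_self]
  · intro h; exact absurd (Finset.mem_univ _) h

/-- `m = 2`: only the update of the word by `R` at a non-red position contributes -/
theorem sum_ocTerm_two (R : OCRates k) (i : Fin k) (z : (parFin k X).Conf) :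
    ∑ w, ocTerm k X u v R w i 2 z
      = if (wordOf k X z i = Ltr.B ∨ wordOf k X z i = Ltr.C) ∧ ocCom k u v (Function.update (wordOf k X z) i Ltr.R)
        then R.x (Function.update (wordOf k X z) i Ltr.R) i / tailCount (parFin k X) u v else 0 := by
  have h0 : ¬ ((2 : Fin 3) = 0) := by decide
  have h1 : ¬ ((2 : Fin 3) = 1) := by decide
  set w0 := wordOf k X z with hw0
  have hoff : ∀ w : Fin k → Ltr, ocTerm k X u v R w i 2 z
      = if ocCom k u v w ∧ w i = Ltr.R ∧ (w0 = Function.update w i Ltr.B ∨ w0 = Function.update w i Ltr.C)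
        then R.x w i / tailCount (parFin k X) u v else 0 := by
    intro w
    unfold ocTerm
    rw [if_neg (show ¬ (ocId k u v w i 2 ∧ w0 = w) from fun h => h0 h.1.1),
      if_neg (show ¬ (ocFl k u v w i 2 ∧ w0 = flipSet k w {i}) from fun h => h1 h.1.1)]
    by_cases hc : ocCom k u v w ∧ w i = Ltr.R ∧ (w0 = Function.update w i Ltr.B ∨ w0 = Function.update w i Ltr.C)
    · rw [if_pos (show ocRx k u v w i 2 ∧ (w0 = Function.update w i Ltr.B ∨ w0 = Function.update w i Ltr.C) from
        ⟨⟨rfl, hc.1, hc.2.1⟩, hc.2.2⟩), if_pos hc]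
    · rw [if_neg (show ¬ (ocRx k u v w i 2 ∧ (w0 = Function.update w i Ltr.B ∨ w0 = Function.update w i Ltr.C)) from
        fun h => hc ⟨h.1.2.1, h.1.2.2, h.2⟩), if_neg hc]
  simp only [hoff]
  rw [Finset.sum_eq_single (Function.update w0 i Ltr.R)]
  · by_cases hc : (w0 i = Ltr.B ∨ w0 i = Ltr.C) ∧ ocCom k u v (Function.update w0 i Ltr.R)
    · rw [if_pos hc, if_pos (show ocCom k u v (Function.update w0 i Ltr.R) ∧ Function.update w0 i Ltr.R i = Ltr.R
        ∧ (w0 = Function.update (Function.update w0 i Ltr.R) i Ltr.B ∨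
          w0 = Function.update (Function.update w0 i Ltr.R) i Ltr.C) from
        ⟨hc.2, by simp, by
          rcases hc.1 with h | h
          · left; rw [Function.update_idem, ← h, Function.update_eq_self]
          · right; rw [Function.update_idem, ← h, Function.update_eq_self]⟩)]
    · rw [if_neg hc, if_neg]
      rintro ⟨hs, -, hz⟩
      apply hc
      refine ⟨?_, hs⟩
      rcases hz with hz | hz
      · left; have := congrFun hz i; simpa using this
      · right; have := congrFun hz i; simpa using this
  · intro w _ hw
    rw [if_neg]
    rintro ⟨-, hi, hz⟩
    apply hw
    rcases hz with hz | hz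
    · rw [hz, Function.update_idem, ← hi, Function.update_eq_self]
    · rw [hz, Function.update_idem, ← hi, Function.update_eq_self]
  · intro h; exact absurd (Finset.mem_univ _) h

end OCTarget

end Summit.Ventures.PercRepro2.Tail2D
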